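/-
Copyright (c) 2026 the pub-hodgecm-mathlib formalisation cell (harness21).  Prover seat hodgecm-mathlib-LH4-p10 (g9), Track B ∕ R90-TF, h413 = `stmt-HodgeConjecture-24833`,
R90-TF section S8 «ContSpec-n½» (S8 dealer R90-CS-plan (g3) S8-R249): the (MS-3∕2) letter `hMS32` of the (V) OF RECORD (★ ED. 13 :157–158) AT THE NAMED WITNESS FAMILY — the `z₀ = 3∕2`
SIBLING of ★ p864687 `hMSP'_midWitness_of_coordLetters`: ★ K2E1-p12 `msBound_middlePole_of_tube_letters_free` (★ p863403 tube-free) packaged at the exports' level, the pole data at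
`3∕2` read off the continued coordinates, BYTE FOR BYTE modulo ONE coordinate pole letter `hqa32` and the global axis letter `hreal`.
-/
import Summits.HodgeConjecture.HodgeConjecture.Theorems.K2E1ChiMaassSelbergOnAxisScalarsOfRecordCMThree   -- ★ p864687 (K2E2-p12): §1 `exists_scalars_of_coords_global`, §2 devices, the sibling head; brings ★ `hE6_midWitness`, ★ `quarterDomains_of_codiscrete`, ★ `eventually_mem_quarterDomains_of_codiscrete`, ★ `integrable_restrict_mul_conj_of_bounded`, ★ witness DEFS
import Summits.HodgeConjecture.HodgeConjecture.Theorems.R90S8ResGMidBlockMSRoadOfLettersU3              -- ★ (K2E1-p12): `msBound_middlePole_of_tube_letters_free` (★ p863403 TUBE-FREE: ★ `maassSelberg_chiPair_cm_three_self_free` → ★ `msRel_of_tube_letters` → ★ `msBound_middlePole_of_chiRelation`)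
import HarnessLib

/-!
# h413 ∕ R90-S8 — `R90S8ResGMidMS32OfRecordU3`: THE (MS-3∕2) LETTER `hMS32` AT THE NAMED WITNESS FAMILY — `‖z − 3∕2‖·‖Λ^T E(z)‖ ≤ C` NEAR `3∕2`, modulo `hqa32` and `hreal`

Cell `pub/hodgecm-mathlib`, crux H413 = `stmt-HodgeConjecture-24833`, route `HCCMUnconditional`; R90-TF section S8 «ContSpec-n½», socket (V) :358 (★ OF RECORD ED. 13 `resGMidBlock_ne_bot_of_record_v13`,
binder `hMS32` :157–158; (V) keeper K2E1-p15 (g4)).  THEOREMS ONLY (no `def`, no `instance`, no `notation`, no named-fact hypothesis, no `sorry`; default heartbeats); lane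
`--supports stmt-HodgeConjecture-24833 --as helper` (count-neutral).  CLOSES NO SOCKET.

THE MATHEMATICS ([MoeglinWaldspurger1995] IV.1.10–IV.1.11, IV.2.3, IV.3.12 (a); [Arthur1980TraceFormulaII] §4; [Langlands1976] §7; [BernsteinLapid2019] §4).  The sibling ★ p864687 bounds the
(E6) truncated family `Fam_T` of the named witness `midWitnessEc` near every REGULAR candidate `z₀ ≠ 3∕2` from (L2) of record (continued scalars `wc`, `Bc` as finite sums of the continued
coordinates `qc_j`) and the regular data («`wc` analytic at `z₀`, `Bc z z` bounded»).  AT THE MIDDLE POLE `3∕2` the Maass–Selberg relation carries the pole terms and the composition of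
record is ★ `msBound_middlePole_of_tube_letters_free`, whose (L3) POLE DATA replace the regular data: `d = (z − 3∕2)·wc` analytic at `3∕2`, `wc` real on the punctured real trace, and
`‖z − 3∕2‖²·‖Bc z z‖` bounded.  These follow from ONE coordinate pole letter «`(z − 3∕2)·qc_j` is analytic at `3∕2`» (the continued coordinates have at most a simple pole at `3∕2` — in
print `qc_j = c_S·a_j` with `a_j` holomorphic and `c_S` the scalar quotient with its simple pole, modulo the unfolding letter) through the closed formulas `wc = (Σ_j qc_j·G_j)·[η]`,
`Bc z z′ = κ·Σ qc_j(z)·conj qc_l(z′)·G_jl`, and from the global axis-reality letter (letter-free at the assembly).  The output `‖(z − 3∕2)•Fam_T z‖ ≤ C` is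
`‖z − 3∕2‖·‖Λ^T E(z)‖_(L²(μ)) ≤ C` since `Fam_T z =ᵐ Λ^T(midWitnessEc z)` off the co-discrete pole set.
* §1 **`hMS32_of_exports_free`** — ★ `hMSP_of_exports_free_at`'s exports-level packager (★ `quarterDomains_of_codiscrete`, ★ `eventually_mem_quarterDomains_of_codiscrete`) feeding
  ★ `msBound_middlePole_of_tube_letters_free`: `∃ C, ∀ᶠ z in 𝓝[≠] (3∕2), ‖(z − 3∕2) • Fam z‖ ≤ C`.
* §2 `exists_poleLetter_of_coords_formula` (`d` analytic, `d = (z − z₀)·wc`), `exists_eventually_sq_norm_kernelDiag_le_of_coords` (`‖z − z₀‖²·‖Bc z z‖` bounded) from the coordinate pole letter.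
* §3 **HEAD `hMS32_midWitness_of_coordLetters`** — ★ ED. 13's binder `hMS32` BYTE FOR BYTE over the sibling's frame, modulo `hqa32` and `hreal`.
HONEST LABEL: HC_CM is proved only modulo the 7 printed citations (2 remaining named inputs: hLiu418 = `stmt-HodgeConjecture-24832`, h413 = `stmt-HodgeConjecture-24833`) until
rung 0 closes; REL ≠ ★ ≠ BUILT; after this file (V)'s `hMS32` = ★ modulo (`hqa32` ⇐ the hunfK-core, `hreal` ★) — the same residual class as `hMSP′`; pays no socket; count-neutral.

## References
* [MoeglinWaldspurger1995] C. Mœglin, J.-L. Waldspurger, *Spectral Decomposition and Eisenstein Series* (1995), IV.1.10–IV.1.11, IV.2.3, IV.3.12 (a).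
* [Arthur1980TraceFormulaII] J. Arthur, *A trace formula for reductive groups II*, Compositio Math. 40 (1980), §4.
* [Langlands1976] R. P. Langlands, *On the Functional Equations Satisfied by Eisenstein Series*, LNM 544 (1976), §7.
* [BernsteinLapid2019] J. Bernstein, E. Lapid, *On the meromorphic continuation of Eisenstein series* (2019), §4.
-/

set_option autoImplicit false
set_option linter.dupNamespace false  -- the mandated namespace `…HodgeConjecture.HodgeConjecture.R90.S8` (LEAD #1 L1) repeats the summit's segment

noncomputable section

open MeasureTheory Measure NumberField IsDedekindDomain Set Filter Topology
open scoped ENNReal NNReal ComplexConjugate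
open Literature.MeasureTheory.Group Literature.NumberTheory Literature.NumberTheory.Automorphic Literature.NumberTheory.Automorphic.UnitaryGroup Literature.NumberTheory.GaloisRepresentations AdelicGroupData
open Literature.NumberTheory.Automorphic.Arthur2013.Leaves.TECR Literature.NumberTheory.Rogawski1990
open Summit.HodgeConjecture.HodgeConjecture.Cruxes.H413.K2E1BorelEisensteinU Summit.HodgeConjecture.HodgeConjecture.Cruxes.H413.K2E1CharacterEisensteinU2Defs
open Summit.HodgeConjecture.HodgeConjecture.Cruxes.H413.K2E1CharacterEisensteinU3PairDefs Summit.HodgeConjecture.HodgeConjecture.Cruxes.H413.K2E1BLBorelSpacesU2Defs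
open Summit.HodgeConjecture.HodgeConjecture.Cruxes.H413.K2E1ChiSectionSpaceU2Defs (chiSectionSpace isChiSection_of_mem)
open Summit.HodgeConjecture.HodgeConjecture.Cruxes.H413.R90S8ResGMidBlockScatteringOfRecordU3 (integrable_restrict_mul_conj_of_bounded)
open Summit.HodgeConjecture.HodgeConjecture.Cruxes.H413.K2E1ChiMaassSelbergPoleExclusionOffAxisCMThree (eventually_mem_quarterDomains_of_codiscrete)
open Summit.HodgeConjecture.HodgeConjecture.Cruxes.H413.K2E1ChiEisensteinRealAxisPoleLedgerOfExportsCMThree (quarterDomains_of_codiscrete)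
open Summit.HodgeConjecture.HodgeConjecture.Cruxes.H413.K2E1ChiTruncatedFamilyTransportCMThree (hE6_midWitness)
open Summit.HodgeConjecture.HodgeConjecture.Cruxes.H413.K2E1ChiEisensteinMeromorphicExportsM1CMThree (one_apply_torus isAutomorphic_one)
open Summit.HodgeConjecture.HodgeConjecture.Cruxes.H413.K2E1ChiMaassSelbergOnAxisScalarsOfRecordCMThree (exists_scalars_of_coords_global continuousAt_kernelDiag_of_coords exists_eventually_norm_le_of_continuousAt eventually_im_eq_zero_of_real_offPoles)

namespace Summit.HodgeConjecture.HodgeConjecture.R90.S8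

/-! ## §1 The exports-level packager at the middle pole `3∕2` -/

section Exports
variable (L : Type) [Field L] [NumberField L] [IsCMField L] [MeasurableSpace (quasiSplit (↥(maximalRealSubfield L)) L (IsCMField.complexConj L) 3).Adelic] [BorelSpace (quasiSplit (↥(maximalRealSubfield L)) L (IsCMField.complexConj L) 3).Adelic]
  [MeasurableSpace (AdeleRing (𝓞 L) L)ˣ] [BorelSpace (AdeleRing (𝓞 L) L)ˣ]

/-- **THE (E6) FAMILY TIMES `(z − 3∕2)` IS BOUNDED NEAR `3∕2` — EXPORTS LEVEL** (★ `hMSP_of_exports_free_at`'s packager at the MIDDLE POLE): for the χ-pair section `φ` with the normalised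
structural data, the exports' continuation `Ec` (tube identity `hE2`) with closed co-discrete candidate pole set `P` and its (E6) truncated `L²` family `Fam` at level `T ≥ 1` (holomorphic on
`Pᶜ`, `Fam z =ᵐ quotFun (Λ^T (Ec z))` off `P`), the continued scalars `wc`, `Bc` holomorphic off `P` with their tube agreements, and the (L3) POLE DATA at `3∕2` (`d = (z − 3∕2)·wc`
analytic, `wc` real on the punctured real trace, `‖z − 3∕2‖²·‖Bc z z‖` bounded): `∃ C, ∀ᶠ z in 𝓝[≠] (3∕2), ‖(z − 3∕2) • Fam z‖ ≤ C` — the quarter-plane domains off `P` (★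
`quarterDomains_of_codiscrete`) fed to ★ `msBound_middlePole_of_tube_letters_free`. [cite: MoeglinWaldspurger1995, IV.2.3, IV.3.12 (a)] [cite: Arthur1980TraceFormulaII, §4] [cite: Langlands1976, §7] -/
theorem hMS32_of_exports_free
    (μ : Measure (quasiSplit (↥(maximalRealSubfield L)) L (IsCMField.complexConj L) 3).automorphicQuotient) [(quasiSplit (↥(maximalRealSubfield L)) L (IsCMField.complexConj L) 3).IsAutomorphicMeasure μ]
    (νG : Measure (quasiSplit (↥(maximalRealSubfield L)) L (IsCMField.complexConj L) 3).Adelic) [νG.IsHaarMeasure] [νG.IsInvInvariant]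
    (μK : Measure ((standardMaximalCompactGL 3 L).comap (adelicVal (↥(maximalRealSubfield L)) L (IsCMField.complexConj L) 3 ((StdForm.antidiagonal 3).over L)) : Subgroup (quasiSplit (↥(maximalRealSubfield L)) L (IsCMField.complexConj L) 3).Adelic))
    [μK.IsHaarMeasure]
    (νI : Measure (AdeleRing (𝓞 L) L)ˣ) [νI.IsHaarMeasure]
    {𝓕I : Set (AdeleRing (𝓞 L) L)ˣ} (h𝓕I : IsIdeleClassDomain L 𝓕I)
    (ν : Measure ↥(adelicUnipotent (↥(maximalRealSubfield L)) L (IsCMField.complexConj L) 3)) [ν.IsHaarMeasure] [ν.IsInvInvariant]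
    {𝓕 : Set ↥(adelicUnipotent (↥(maximalRealSubfield L)) L (IsCMField.complexConj L) 3)} (h𝓕N : IsFundamentalDomain ↥(rationalUnipotent (↥(maximalRealSubfield L)) L (IsCMField.complexConj L) 3) 𝓕 ν) (h𝓕1 : ν 𝓕 = 1)
    (h𝓕c : IsCompact (closure 𝓕))
    {β : (quasiSplit (↥(maximalRealSubfield L)) L (IsCMField.complexConj L) 3).Adelic → ℝ≥0∞} (hβ : IsCoveringWeight ((arithmeticBorel (↥(maximalRealSubfield L)) L (IsCMField.complexConj L) 3).map (quasiSplit (↥(maximalRealSubfield L)) L (IsCMField.complexConj L) 3).arithmeticSubgroup.subtype) β)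
    {T : ℝ≥0} (hT : 1 ≤ T)
    {χ₁ : HeckeCharacter L} {χ₂ : ↥(TorusDict.torus (IsCMField.complexConj L)) →ₜ* ℂˣ}
    (hχ₁ : χ₁.IsUnitary) (hρ₁ : ∀ r : ℝ≥0ˣ, χ₁ (posRealIdele L r) = 1) (hχ₂u : ∀ u, ‖((χ₂ u : ℂˣ) : ℂ)‖ = 1) (hχ₂ : TorusDict.IsAutomorphic (IsCMField.complexConj L) χ₂)
    {φ : (quasiSplit (↥(maximalRealSubfield L)) L (IsCMField.complexConj L) 3).Adelic → ℂ} (hφc : Continuous φ) (hφ : IsChiSectionPair χ₁ χ₂ φ) {Cφ : ℝ} (hφC : ∀ x, ‖φ x‖ ≤ Cφ)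
    -- the exports: tube identity, candidate pole set, the (E6) family at level `T`
    (Ec : ℂ → (quasiSplit (↥(maximalRealSubfield L)) L (IsCMField.complexConj L) 3).Adelic → ℂ) (hE2 : ∀ z : ℂ, 2 < z.re → Ec z = eisensteinSeriesU (flatSectionU φ z))
    {P : Set ℂ} (hPc : IsClosed P) (hPcd : ∀ z₀ : ℂ, ∀ᶠ s in 𝓝[≠] z₀, s ∉ P)
    (Fam : ℂ → Lp ℂ 2 μ) (hFd : DifferentiableOn ℂ Fam Pᶜ)
    (hFam : ∀ z : ℂ, z ∉ P → ((Fam z : Lp ℂ 2 μ) : (quasiSplit (↥(maximalRealSubfield L)) L (IsCMField.complexConj L) 3).automorphicQuotient → ℂ) =ᵐ[μ] (quasiSplit (↥(maximalRealSubfield L)) L (IsCMField.complexConj L) 3).quotFun (truncation ν 𝓕 T (Ec z)))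
    -- (L2) the continued scalars, holomorphic off `P`, with their tube agreements
    {wc : ℂ → ℂ} (hwc : DifferentiableOn ℂ wc Pᶜ)
    (hwagree : ∀ s : ℂ, 2 < s.re → wc s = ∫ x in {x : (AdeleRing (𝓞 L) L)ˣ | (IdeleClassGroup.ideleNorm L x : ℝ) ≤ 1} ∩ 𝓕I, ((IdeleClassGroup.ideleNorm L x : ℝ) : ℂ) * (((reflectChar (IsCMField.complexConj L) χ₁ x : ℂˣ) : ℂ) * conj ((χ₁ x : ℂˣ) : ℂ) * (∫ k, (fun g : (quasiSplit (↥(maximalRealSubfield L)) L (IsCMField.complexConj L) 3).Adelic => (∫ v : ↥(adelicUnipotent (↥(maximalRealSubfield L)) L (IsCMField.complexConj L) 3), flatSectionU φ s ((quasiSplit (↥(maximalRealSubfield L)) L (IsCMField.complexConj L) 3).toAdelic (weylLongU ((IsCMField.complexConj L : L ≃ₐ[↥(maximalRealSubfield L)] L) : L →+* L) (rfl : (StdForm.antidiagonal 3).over L = (StdForm.antidiagonal 3).over L)) * ((v : (quasiSplit (↥(maximalRealSubfield L)) L (IsCMField.complexConj L) 3).Adelic) * g)) ∂ν) * ((borelHeight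 g : ℝ) : ℂ) ^ (s - 2)) (k : (quasiSplit (↥(maximalRealSubfield L)) L (IsCMField.complexConj L) 3).Adelic) * conj (φ (k : (quasiSplit (↥(maximalRealSubfield L)) L (IsCMField.complexConj L) 3).Adelic)) ∂μK)) ∂νI)
    {Bc : ℂ → ℂ → ℂ} (hBc1 : ∀ z' : ℂ, DifferentiableOn ℂ (fun z : ℂ => Bc z z') Pᶜ) (hBc2 : ∀ z : ℂ, DifferentiableOn ℂ (fun u : ℂ => Bc z (conj u)) {u : ℂ | conj u ∉ P})
    (hBagree : ∀ s s' : ℂ, 2 < s.re → 2 < s'.re → Bc s s' = (∫ x in {x : (AdeleRing (𝓞 L) L)ˣ | (IdeleClassGroup.ideleNorm L x : ℝ) ≤ 1} ∩ 𝓕I, ((IdeleClassGroup.ideleNorm L x : ℝ) : ℂ) ∂νI) * (∫ k, (fun g : (quasiSplit (↥(maximalRealSubfield L)) L (IsCMField.complexConj L) 3).Adelic => (∫ v : ↥(adelicUnipotent (↥(maximalRealSubfield L)) L (IsCMField.complexConj L) 3), flatSectionU φ s ((quasiSplit (↥(maximalRealSubfield L)) L (IsCMField.complexConj L) 3).toAdelic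 (weylLongU ((IsCMField.complexConj L : L ≃ₐ[↥(maximalRealSubfield L)] L) : L →+* L) (rfl : (StdForm.antidiagonal 3).over L = (StdForm.antidiagonal 3).over L)) * ((v : (quasiSplit (↥(maximalRealSubfield L)) L (IsCMField.complexConj L) 3).Adelic) * g)) ∂ν) * ((borelHeight g : ℝ) : ℂ) ^ (s - 2)) (k : (quasiSplit (↥(maximalRealSubfield L)) L (IsCMField.complexConj L) 3).Adelic) * conj ((fun g : (quasiSplit (↥(maximalRealSubfield L)) L (IsCMField.complexConj L) 3).Adelic => (∫ v : ↥(adelicUnipotent (↥(maximalRealSubfield L)) L (IsCMField.complexConj L) 3), flatSectionU φ s' ((quasiSplit (↥(maximalRealSubfield L)) L (IsCMField.complexConj L) 3).toAdelic (weylLongU ((IsCMField.complexConj L : L ≃ₐ[↥(maximalRealSubfield L)] L) : L →+* L) (rfl : (StdForm.antidiagonal 3).over L = (StdForm.antidiagonal 3).over L)) * ((v : (quasiSplit (↥(maximalRealSubfield L)) L (IsCMField.complexConj L) 3).Adelic) * g)) ∂ν) * ((borelHeight g : ℝ) : ℂ) ^ (s' - 2)) (k : (quasiSplit (↥(maximalRealSubfield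 L)) L (IsCMField.complexConj L) 3).Adelic)) ∂μK))
    -- (L3) the pole data at `3∕2`
    {d : ℂ → ℂ} (hd : AnalyticAt ℂ d (3 / 2 : ℂ)) (hdw : ∀ᶠ z in 𝓝[≠] ((3 / 2 : ℂ)), d z = (z - 3 / 2) * wc z)
    (hreal : ∀ᶠ x : ℝ in 𝓝[≠] (3 / 2 : ℝ), (wc (x : ℂ)).im = 0)
    (hβB : ∃ B : ℝ, ∀ᶠ z in 𝓝[≠] ((3 / 2 : ℂ)), ‖z - 3 / 2‖ ^ 2 * ‖Bc z z‖ ≤ B) :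
    ∃ C : ℝ, ∀ᶠ z in 𝓝[≠] ((3 / 2 : ℂ)), ‖(z - 3 / 2) • Fam z‖ ≤ C := by
  obtain ⟨⟨hD₁, hD₁c, hD₁sub, ⟨O₁, O₂', hO₁, hO₁ne, hO₁D, hO₂', hO₂'ne, hO₂'D, hsep⟩, -⟩, ⟨hD₂, hD₂c, hD₂sub, ⟨Q₁, Q₂', hQ₁, hQ₁ne, hQ₁D, hQ₂', hQ₂'ne, hQ₂'D, hsep₂⟩, -⟩⟩ :=
    quarterDomains_of_codiscrete hPc hPcd one_lt_two
  have h32 : (((3 / 2 : ℝ)) : ℂ) = (3 / 2 : ℂ) := by push_cast; ring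
  have hz₀ : 1 < ((3 / 2 : ℂ)).re := by rw [← h32, Complex.ofReal_re]; norm_num
  obtain ⟨hD₁ev, hD₂ev⟩ := eventually_mem_quarterDomains_of_codiscrete hPcd hz₀
  have hFtube : ∀ D : Set ℂ, D ⊆ Pᶜ → ∀ z ∈ D, 2 < z.re → ((Fam z : Lp ℂ 2 μ) : (quasiSplit (↥(maximalRealSubfield L)) L (IsCMField.complexConj L) 3).automorphicQuotient → ℂ) =ᵐ[μ]
      (quasiSplit (↥(maximalRealSubfield L)) L (IsCMField.complexConj L) 3).quotFun (truncation ν 𝓕 T (eisensteinSeriesU (flatSectionU φ z))) := fun D hD z hz hz2 => by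
    rw [← hE2 z hz2]; exact hFam z (hD hz)
  have hD₁P : ((({z : ℂ | 1 < z.re} ∩ {z : ℂ | 0 < z.im}) ∩ univ) \ P) ⊆ Pᶜ := fun z hz => hz.2
  have hD₂P : ((({z : ℂ | 1 < z.re} ∩ {z : ℂ | z.im < 0}) ∩ univ) \ P) ⊆ Pᶜ := fun z hz => hz.2
  exact msBound_middlePole_of_tube_letters_free L μ νG μK νI h𝓕I ν h𝓕N h𝓕1 h𝓕c hβ hT hχ₁ hρ₁ hχ₂u hχ₂ hφc hφ hφC hD₁ hD₁c hD₁sub hO₁ hO₁ne hO₁D hO₂' hO₂'ne hO₂'D hsep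
    hD₂ hD₂c hD₂sub hQ₁ hQ₁ne hQ₁D hQ₂' hQ₂'ne hQ₂'D hsep₂ hD₁ev hD₂ev Fam (hFd.mono hD₁P) (hFd.mono hD₂P) hPc.isOpen_compl (hPcd _) hFd.continuousOn
    (hFtube _ hD₁P) (hFtube _ hD₂P) (hwc.mono hD₁P) (hwc.mono hD₂P) hwagree (fun z' _ => (hBc1 z').mono hD₁P) (fun z _ => (hBc2 z).mono fun u hu => hu.2)
    (fun z' _ => (hBc1 z').mono hD₂P) (fun z _ => (hBc2 z).mono fun u hu => hu.2) hBagree hd hdw hreal hβB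

end Exports

/-! ## §2 The pole data at `z₀` from the coordinate pole letter -/

section PoleData

variable {ι : Type} [Fintype ι]

/-- **THE POLE LETTER `d` FROM THE COORDINATES**: if every `(z − z₀)·qc_j` is analytic at `z₀`, then `d z := (Σ_j ((z − z₀)·qc_j z)·G_j)·c` is analytic at `z₀` and `d = (z − z₀)·wc` for the
closed formula `wc z = (Σ_j qc_j(z)·G_j)·c`. [cite: MoeglinWaldspurger1995, IV.1.11] [cite: BernsteinLapid2019, §4 p. 10] -/
theorem exists_poleLetter_of_coords_formula {qc : ι → ℂ → ℂ} {z₀ : ℂ} (hqa : ∀ j, AnalyticAt ℂ (fun z : ℂ => (z - z₀) * qc j z) z₀) (G : ι → ℂ) (c : ℂ) {wc : ℂ → ℂ}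
    (hwc : ∀ z : ℂ, wc z = (∑ j, qc j z * G j) * c) :
    ∃ d : ℂ → ℂ, AnalyticAt ℂ d z₀ ∧ ∀ᶠ z in 𝓝[≠] z₀, d z = (z - z₀) * wc z := by
  refine ⟨fun z => (∑ j, ((z - z₀) * qc j z) * G j) * c,
    (Finset.analyticAt_fun_sum Finset.univ fun j _ => (hqa j).mul analyticAt_const).mul analyticAt_const, Eventually.of_forall fun z => ?_⟩
  show (∑ j, ((z - z₀) * qc j z) * G j) * c = (z - z₀) * wc z
  rw [hwc z, ← mul_assoc, Finset.mul_sum]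
  exact congrArg (· * c) (Finset.sum_congr rfl fun j _ => by ring)

/-- **`‖z − z₀‖²·‖Bc z z‖` IS BOUNDED NEAR `z₀` FROM THE COORDINATE POLE LETTER** (closed formula `Bc s s′ = κ·Σ qc_j(s)·conj qc_l(s′)·G_jl`): `(z − z₀)·conj(z − z₀)·Bc z z =
κ·Σ ((z − z₀)qc_j z)·conj((z − z₀)qc_l z)·G_jl` is continuous at `z₀`. [cite: MoeglinWaldspurger1995, IV.1.11] [cite: BernsteinLapid2019, §4 p. 10] -/
theorem exists_eventually_sq_norm_kernelDiag_le_of_coords {qc : ι → ℂ → ℂ} {z₀ : ℂ} (hqa : ∀ j, AnalyticAt ℂ (fun z : ℂ => (z - z₀) * qc j z) z₀) (κ : ℂ) (G : ι → ι → ℂ)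
    {Bc : ℂ → ℂ → ℂ} (hBc : ∀ s s' : ℂ, Bc s s' = κ * ∑ j, ∑ l, qc j s * conj (qc l s') * G j l) :
    ∃ B : ℝ, ∀ᶠ z in 𝓝[≠] z₀, ‖z - z₀‖ ^ 2 * ‖Bc z z‖ ≤ B := by
  have hcont : ContinuousAt (fun z : ℂ => κ * ∑ j, ∑ l, ((z - z₀) * qc j z) * conj ((z - z₀) * qc l z) * G j l) z₀ :=
    continuousAt_kernelDiag_of_coords (qc := fun j z => (z - z₀) * qc j z) hqa κ G
  obtain ⟨B, hB⟩ := exists_eventually_norm_le_of_continuousAt hcont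
  refine ⟨B, hB.mono fun z hz => ?_⟩
  have key : (z - z₀) * conj (z - z₀) * Bc z z = κ * ∑ j, ∑ l, ((z - z₀) * qc j z) * conj ((z - z₀) * qc l z) * G j l := by
    rw [hBc z z]
    simp only [map_mul, Finset.mul_sum]
    exact Finset.sum_congr rfl fun j _ => Finset.sum_congr rfl fun l _ => by ring
  have hn : ‖(z - z₀) * conj (z - z₀) * Bc z z‖ = ‖z - z₀‖ ^ 2 * ‖Bc z z‖ := by
    rw [norm_mul, norm_mul, Complex.norm_conj, sq]
  rw [← hn, key]
  exact hz

end PoleData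

/-! ## §3 HEAD OF RECORD: `hMS32` at the named witness family, modulo the coordinate pole letter and the axis letter -/

section OfRecord
variable (L : Type) [Field L] [NumberField L] [IsCMField L] [MeasurableSpace (quasiSplit (↥(maximalRealSubfield L)) L (IsCMField.complexConj L) 3).Adelic] [BorelSpace (quasiSplit (↥(maximalRealSubfield L)) L (IsCMField.complexConj L) 3).Adelic]
  [MeasurableSpace (arch (↥(maximalRealSubfield L)) L (IsCMField.complexConj L) 3 ((StdForm.antidiagonal 3).over L))] [BorelSpace (arch (↥(maximalRealSubfield L)) L (IsCMField.complexConj L) 3 ((StdForm.antidiagonal 3).over L))]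
  [MeasurableSpace (finAdelic (↥(maximalRealSubfield L)) L (IsCMField.complexConj L) 3 ((StdForm.antidiagonal 3).over L))] [BorelSpace (finAdelic (↥(maximalRealSubfield L)) L (IsCMField.complexConj L) 3 ((StdForm.antidiagonal 3).over L))]
  [MeasurableSpace (AdeleRing (𝓞 L) L)ˣ] [BorelSpace (AdeleRing (𝓞 L) L)ˣ]

/-- **`hMS32` AT THE NAMED WITNESS FAMILY, OF THE COORDINATE POLE LETTER AND THE AXIS LETTER** — the binder `hMS32` of the (V) OF RECORD ★ ED. 13 (:157–158), BYTE FOR BYTE: for every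
level `T ≥ 1`, `‖z − 3∕2‖·‖Λ^T(midWitnessEc z)‖_(L²(μ)) ≤ C` on a punctured neighbourhood of `3∕2`.  Binders: the sibling ★ `hMSP'_midWitness_of_coordLetters`' frame VERBATIM (★
`midWitnessExports_spec`'s data, the Maass–Selberg frame extras `μK`, `νI`, `𝓕I`, `ν 𝓕 = 1`, `χ` unitary and trivial on the positive reals), then THE TWO NAMED LETTERS — `hqa32`: every
`(z − 3∕2)·midWitnessQc j` is analytic at `3∕2` (the continued coordinates have at most a simple pole there); `hreal`: the closed-formula `wc` of record is real at every real `x > 1` off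
`midWitnessP` (the sibling's bytes).  PROOF: ★ `hE6_midWitness` (the family), ★ `exists_scalars_of_coords_global` ((L2) of record), §2 (pole data), ★ `eventually_im_eq_zero_of_real_offPoles`,
§1; then `‖(z − 3∕2)•Fam z‖ = ‖z − 3∕2‖·‖Λ^T E(z)‖_(L²)` off the co-discrete `midWitnessP` (`Lp.norm_def`, `eLpNorm_congr_ae`).
[cite: MoeglinWaldspurger1995, IV.1.10–IV.1.11, IV.2.3, IV.3.12 (a)] [cite: BernsteinLapid2019, §4 p. 10] [cite: Rogawski1990, §13.9 p. 229] -/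
theorem hMS32_midWitness_of_coordLetters
    (μ : Measure (quasiSplit (↥(maximalRealSubfield L)) L (IsCMField.complexConj L) 3).automorphicQuotient) [(quasiSplit (↥(maximalRealSubfield L)) L (IsCMField.complexConj L) 3).IsAutomorphicMeasure μ]
    (νG : Measure (quasiSplit (↥(maximalRealSubfield L)) L (IsCMField.complexConj L) 3).Adelic) [νG.IsHaarMeasure] [νG.IsInvInvariant] [SFinite νG]
    (ν : Measure ↥(adelicUnipotent (↥(maximalRealSubfield L)) L (IsCMField.complexConj L) 3)) [ν.IsHaarMeasure] [ν.IsMulRightInvariant] [ν.IsInvInvariant]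
    {𝓕 : Set ↥(adelicUnipotent (↥(maximalRealSubfield L)) L (IsCMField.complexConj L) 3)}
    (h𝓕N : IsFundamentalDomain ↥(rationalUnipotent (↥(maximalRealSubfield L)) L (IsCMField.complexConj L) 3) 𝓕 ν) (h𝓕c : IsCompact (closure 𝓕)) (h𝓕₀ : ν 𝓕 ≠ 0)
    {β : (quasiSplit (↥(maximalRealSubfield L)) L (IsCMField.complexConj L) 3).Adelic → ℝ≥0∞}
    (hβ : IsCoveringWeight ↥((arithmeticBorel (↥(maximalRealSubfield L)) L (IsCMField.complexConj L) 3).map (quasiSplit (↥(maximalRealSubfield L)) L (IsCMField.complexConj L) 3).arithmeticSubgroup.subtype) β)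
    {μZ : Measure (borelQuotient (↥(maximalRealSubfield L)) L (IsCMField.complexConj L) 3)} [SFinite μZ]
    (hμZ : ∀ f : borelQuotient (↥(maximalRealSubfield L)) L (IsCMField.complexConj L) 3 → ℝ≥0∞, Measurable f → ∫⁻ z, f z ∂μZ = ∫⁻ g, β g * f (toBorelQuotient (↥(maximalRealSubfield L)) L (IsCMField.complexConj L) 3 g) ∂νG)
    -- the M1 family: `φ ∈ V(χ, K, 1)` continuous bounded with `φ ∘ ι_∞ = φ(1)`, and a basis of `V(χʷ, K, 1)` by continuous bounded functions
    {χ : HeckeCharacter L} {K' : Subgroup (quasiSplit (↥(maximalRealSubfield L)) L (IsCMField.complexConj L) 3).Adelic} {ω : ↥K' → ℂ} {φ : (quasiSplit (↥(maximalRealSubfield L)) L (IsCMField.complexConj L) 3).Adelic → ℂ} (hφV : φ ∈ chiSectionSpace χ K' ω) (hφc : Continuous φ) {Mφ : ℝ} (hφM : ∀ x, ‖φ x‖ ≤ Mφ)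
    -- the LEVEL: `K′ ≤ K`, `ι(K_∞) ⊆ K′`, an open compact `U₀` with `ι_f(U₀ ∩ G_f) ⊆ K′` on which `ω = 1`, continuity of the sections; auxiliary Haar measures on `G_∞` (two-sided) and `G(𝔸_f)`
    (hK' : K' ≤ ((standardMaximalCompactGL 3 L).comap (adelicVal (↥(maximalRealSubfield L)) L (IsCMField.complexConj L) 3 ((StdForm.antidiagonal 3).over L)) : Subgroup (quasiSplit (↥(maximalRealSubfield L)) L (IsCMField.complexConj L) 3).Adelic))
    (hKinf : ∀ k : arch (↥(maximalRealSubfield L)) L (IsCMField.complexConj L) 3 ((StdForm.antidiagonal 3).over L), adelicVal (↥(maximalRealSubfield L)) L (IsCMField.complexConj L) 3 ((StdForm.antidiagonal 3).over L) (archToAdelic (↥(maximalRealSubfield L)) L (IsCMField.complexConj L) 3 _ k) ∈ standardMaximalCompactGL 3 L →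
      archToAdelic (↥(maximalRealSubfield L)) L (IsCMField.complexConj L) 3 _ k ∈ K')
    (U₀ : Subgroup (GL (Fin 3) (FiniteAdeleRing (𝓞 L) L))) (hU₀o : IsOpen (U₀ : Set (GL (Fin 3) (FiniteAdeleRing (𝓞 L) L)))) (hU₀c : IsCompact (U₀ : Set (GL (Fin 3) (FiniteAdeleRing (𝓞 L) L))))
    (hU : ∀ b : finAdelic (↥(maximalRealSubfield L)) L (IsCMField.complexConj L) 3 ((StdForm.antidiagonal 3).over L), (b : GL (Fin 3) (FiniteAdeleRing (𝓞 L) L)) ∈ U₀ →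
      ∃ hb : finAdelicToAdelic (↥(maximalRealSubfield L)) L (IsCMField.complexConj L) 3 ((StdForm.antidiagonal 3).over L) b ∈ K', ω ⟨_, hb⟩ = 1)
    (hVc : ∀ φ ∈ chiSectionSpace χ K' ω, Continuous φ)
    (μa : Measure (arch (↥(maximalRealSubfield L)) L (IsCMField.complexConj L) 3 ((StdForm.antidiagonal 3).over L))) [μa.IsHaarMeasure] [μa.IsMulRightInvariant]
    (μf : Measure (finAdelic (↥(maximalRealSubfield L)) L (IsCMField.complexConj L) 3 ((StdForm.antidiagonal 3).over L))) [μf.IsHaarMeasure]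
    {ι' : Type} [Fintype ι'] [DecidableEq ι'] (bV : Module.Basis ι' ℂ ↥(chiSectionSpace (reflectChar (IsCMField.complexConj L) χ) K' ω))
    (hbc : ∀ j, Continuous ((bV j : ↥(chiSectionSpace (reflectChar (IsCMField.complexConj L) χ) K' ω)) : (quasiSplit (↥(maximalRealSubfield L)) L (IsCMField.complexConj L) 3).Adelic → ℂ)) {Mb : ℝ} (hbM : ∀ j x, ‖((bV j : ↥(chiSectionSpace (reflectChar (IsCMField.complexConj L) χ) K' ω)) : (quasiSplit (↥(maximalRealSubfield L)) L (IsCMField.complexConj L) 3).Adelic → ℂ) x‖ ≤ Mb)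
    (h2 : Module.finrank (↥(maximalRealSubfield L)) L = 2) (hc : IsCMField.complexConj L ≠ 1) (hJ : ((StdForm.antidiagonal 3).over L).det ≠ 0)
    (ψ : ↥(TorusDict.torus (IsCMField.complexConj L)) →ₜ* ℂˣ) (hψ : TorusDict.IsAutomorphic (IsCMField.complexConj L) ψ)
    -- the Maass–Selberg frame extras
    (μK : Measure ((standardMaximalCompactGL 3 L).comap (adelicVal (↥(maximalRealSubfield L)) L (IsCMField.complexConj L) 3 ((StdForm.antidiagonal 3).over L)) : Subgroup (quasiSplit (↥(maximalRealSubfield L)) L (IsCMField.complexConj L) 3).Adelic))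
    [μK.IsHaarMeasure]
    (νI : Measure (AdeleRing (𝓞 L) L)ˣ) [νI.IsHaarMeasure]
    {𝓕I : Set (AdeleRing (𝓞 L) L)ˣ} (h𝓕I : IsIdeleClassDomain L 𝓕I) (h𝓕1 : ν 𝓕 = 1)
    (hχ₁ : χ.IsUnitary) (hρ₁ : ∀ r : ℝ≥0ˣ, χ (posRealIdele L r) = 1)
    -- THE TWO NAMED GLOBAL LETTERS: coordinate analyticity at the candidates off `3∕2` (the scalar half), axis reality of the closed-formula `wc` of record
    -- THE COORDINATE POLE LETTER AT `3∕2`: every continued coordinate has at most a simple pole at `3∕2`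
    (hqa32 : ∀ j, AnalyticAt ℂ (fun z : ℂ => (z - (3 : ℂ) / 2) * midWitnessQc L μ νG ν h𝓕N h𝓕c h𝓕₀ hβ hμZ hφV hφc hφM hK' hKinf U₀ hU₀o hU₀c hU hVc μa μf bV hbc hbM h2 hc hJ ψ hψ j z) ((3 : ℂ) / 2))
    (hreal : ∀ x : ℝ, 1 < x → ((x : ℝ) : ℂ) ∉ midWitnessP L μ νG ν h𝓕N h𝓕c h𝓕₀ hβ hμZ hφV hφc hφM hK' hKinf U₀ hU₀o hU₀c hU hVc μa μf bV hbc hbM h2 hc hJ ψ hψ →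
      (((∑ j, midWitnessQc L μ νG ν h𝓕N h𝓕c h𝓕₀ hβ hμZ hφV hφc hφM hK' hKinf U₀ hU₀o hU₀c hU hVc μa μf bV hbc hbM h2 hc hJ ψ hψ j (x : ℂ) * ∫ k, ((bV j : ↥(chiSectionSpace (reflectChar (IsCMField.complexConj L) χ) K' ω)) : (quasiSplit (↥(maximalRealSubfield L)) L (IsCMField.complexConj L) 3).Adelic → ℂ) (k : (quasiSplit (↥(maximalRealSubfield L)) L (IsCMField.complexConj L) 3).Adelic) * conj (φ (k : (quasiSplit (↥(maximalRealSubfield L)) L (IsCMField.complexConj L) 3).Adelic)) ∂μK) *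
        ∫ x in {x : (AdeleRing (𝓞 L) L)ˣ | (IdeleClassGroup.ideleNorm L x : ℝ) ≤ 1} ∩ 𝓕I, ((IdeleClassGroup.ideleNorm L x : ℝ) : ℂ) * (((reflectChar (IsCMField.complexConj L) χ x : ℂˣ) : ℂ) * conj ((χ x : ℂˣ) : ℂ)) ∂νI)).im = 0) :
    ∀ T : ℝ≥0, 1 ≤ T →
      ∃ C : ℝ, ∀ᶠ z in 𝓝[≠] ((3 : ℂ) / 2), ‖z - (3 : ℂ) / 2‖ * (eLpNorm ((quasiSplit (↥(maximalRealSubfield L)) L (IsCMField.complexConj L) 3).quotFun (truncation ν 𝓕 T (midWitnessEc L μ νG ν h𝓕N h𝓕c h𝓕₀ hβ hμZ hφV hφc hφM hK' hKinf U₀ hU₀o hU₀c hU hVc μa μf bV hbc hbM h2 hc hJ ψ hψ z))) 2 μ).toReal ≤ C := by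
  intro T hT
  -- the spec's clauses: 2 `hqφ`, 5 tube identity, 6 `qc = q` on the tube, 7 closed, 8 co-discrete, 13 `qc` holomorphic off `P`
  obtain ⟨-, hqφ, -, -, hE2, hqcq, hPc, hPcd, -, -, -, -, hqcP, -, -, -⟩ := midWitnessExports_spec L μ νG ν h𝓕N h𝓕c h𝓕₀ hβ hμZ hφV hφc hφM hK' hKinf U₀ hU₀o hU₀c hU hVc μa μf bV hbc hbM h2 hc hJ ψ hψ
  -- the (E6) family at the named pair
  obtain ⟨Fam, hFd, hFam⟩ := hE6_midWitness L μ νG ν h𝓕N h𝓕c h𝓕₀ hβ hμZ hφV hφc hφM hK' hKinf U₀ hU₀o hU₀c hU hVc μa μf bV hbc hbM h2 hc hJ ψ hψ hT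
  -- (L2) of record on the basis `bV` of `V(χʷ, K′, ω)`
  obtain ⟨wc, Bc, hwc, hwagree, hBc1, hBc2, hBagree, hwcf, hBcf⟩ := exists_scalars_of_coords_global L μK νI 𝓕I ν h𝓕1 χ φ
    (fun j => ((bV j : ↥(chiSectionSpace (reflectChar (IsCMField.complexConj L) χ) K' ω)) : (quasiSplit (↥(maximalRealSubfield L)) L (IsCMField.complexConj L) 3).Adelic → ℂ))
    hqφ hqcP hqcq hPc (fun j => integrable_restrict_mul_conj_of_bounded L μK (hbc j) hφc (hbM j) hφM)
    (fun j l => integrable_restrict_mul_conj_of_bounded L μK (hbc j) (hbc l) (hbM j) (hbM l))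
  -- the M1 section as a pair section with `χ₂ := 1`
  have hφ : IsChiSectionPair χ (1 : ↥(TorusDict.torus (IsCMField.complexConj L)) →ₜ* ℂˣ) φ :=
    IsChiSection.isChiSectionPair_of_trivial (one_apply_torus (IsCMField.complexConj L)) (isChiSection_of_mem hφV)
  have hχ₂u : ∀ u : ↥(TorusDict.torus (IsCMField.complexConj L)), ‖(((1 : ↥(TorusDict.torus (IsCMField.complexConj L)) →ₜ* ℂˣ) u : ℂˣ) : ℂ)‖ = 1 := fun u => by
    rw [one_apply_torus]; simp
  -- (L3) the pole data at `3∕2` from the coordinate pole letter (§2) and the axis letter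
  obtain ⟨d, hd, hdw⟩ := exists_poleLetter_of_coords_formula hqa32 _ _ hwcf
  have hβB := exists_eventually_sq_norm_kernelDiag_le_of_coords hqa32 _ _ hBcf
  have hreal' : ∀ᶠ x : ℝ in 𝓝[≠] (3 / 2 : ℝ), (wc (x : ℂ)).im = 0 :=
    eventually_im_eq_zero_of_real_offPoles hPcd (fun x hx hxP => by rw [hwcf]; exact hreal x hx hxP) (by norm_num)
  obtain ⟨C, hC⟩ := hMS32_of_exports_free L μ νG μK νI h𝓕I ν h𝓕N h𝓕1 h𝓕c hβ hT hχ₁ hρ₁ hχ₂u (isAutomorphic_one (IsCMField.complexConj L)) hφc hφ hφM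
    (midWitnessEc L μ νG ν h𝓕N h𝓕c h𝓕₀ hβ hμZ hφV hφc hφM hK' hKinf U₀ hU₀o hU₀c hU hVc μa μf bV hbc hbM h2 hc hJ ψ hψ) hE2 hPc hPcd Fam hFd hFam hwc hwagree hBc1 hBc2 hBagree hd hdw hreal' hβB
  refine ⟨C, ?_⟩
  filter_upwards [hC, hPcd ((3 : ℂ) / 2)] with z hz hzP
  rw [← eLpNorm_congr_ae (hFam z hzP), ← Lp.norm_def, ← norm_smul]
  exact hz

end OfRecord

end Summit.HodgeConjecture.HodgeConjecture.R90.S8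

end
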